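import Summits.Ventures.PercRepro.S1CoreCapUncond
import Summits.Ventures.PercRepro.RankLevelSetLocalSparse

/-!
# PercRepro — `s₄ ≤ 32` ON EVERY `e`-FREE CORE OF NULLITY `5`, UNCONDITIONALLY (p2, gen 20; SUBCLAIM-S1 §6.3 (xxiii) / §6.4)

The ONE cap the row `p = 12` of the `q = 4` window still needed (S1RowTwelveCap32: `c025_four_twelve_of_cap32`,
modulo «`s₄ ≤ 32` on every core of nullity `5`»; the unconditional table of S1CoreCapUncond stops at `33`, and the
cell `(12, 5)` reads `1.0004` at `33` against `0.9965` at `32`). The proof is p1's averaging recursion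
(S1CoreCapAvg, stated there for nullity `≥ 7` with `≥ d + 6` non-coloops) read at nullity `5`:

* the non-coloops `E' = E ∖ K` of a core of nullity `5` number at least `9` (`card_nonColoops_ge_nine`):
  `r(E) = r(E') + |K|` (p3's `eRk_union_subset_coloops`), so `|E'| = r(E') + 5`; `r(E') ≤ 3` would give `≤ 6`
  points (planes of the core), hence `r(E') ≤ 1`, hence `|E'| + 1 ≤ 2` (`ncard_add_one_le_two_pow_of_eRk_le`) —
  against `|E'| ≥ 5`;
* the recursion with an explicit count `m` of non-coloops (`ncard_fourCircuits_sub_div_le_of_nonColoops`): some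
  non-coloop `x` lies on at most `⌊4·s₄/m⌋` four-circuits (`exists_nonColoop_ncard_fourCircuitsThrough_le`);
  `M ＼ {x}` is a core of nullity one less (`hfree_delete`, `dual_eRank_delete_singleton_add_one`) and
  `s₄(M) ≤ #4circ(x) + s₄(M ＼ {x})` (`ncard_fourCircuits_le_through_add_delete`);
* at nullity `5`, with `m = 9` and `s₄ ≤ capKer 4 = 18` at nullity `4` (S1CoreCapUncond — the kernel per-point
  instances `Q*(0..4) = 0, 1, 4, 5, 8`, no computed hypothesis): `s₄ − ⌊4·s₄/9⌋ ≤ 18`, and `33 − ⌊132/9⌋ = 19 > 18`,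
  so **`s₄ ≤ 32`** (`ncard_fourCircuits_le_thirty_two_uncond`). The computed value is `29` (`Q*(5) = 11`).

Axioms: standard.
-/

open scoped Matroid

namespace PercRepro

namespace S1

open Set

open FourCap

variable {α : Type}

/-- **The non-coloops of a core of nullity `5` number at least `9`**: with `K` the coloops and `E' = E ∖ K`,
`r(E) = r(E') + |K|`, so `|E'| = r(E') + 5`; `r(E') ≤ 3` would give `|E'| ≤ 6` (planes of the core), hence
`r(E') ≤ 1` and `|E'| ≤ 1` (lines of the core: `|X| + 1 ≤ 2^{r(X)}`) — against `|E'| ≥ 5`. -/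
theorem card_nonColoops_ge_nine (M : Matroid α) [M.Finite]
    (hfree : ∀ e ∈ M.E, ∃ A ⊆ M.E \ {e}, e ∉ M.closure A ∧ e ∉ M.closure ((M.E \ {e}) \ A))
    (hd : M.E.encard = M.eRank + 5) :
    9 ≤ (M.E \ M.coloops).ncard := by
  have hK : M.coloops ⊆ M.E := M.coloops_subset_ground
  have hE' : M.E \ M.coloops ⊆ M.E := sdiff_subset
  have hunion : (M.E \ M.coloops) ∪ M.coloops = M.E := sdiff_union_of_subset hK
  have hr := PercRepro.eRk_union_subset_coloops (M := M) hE' subset_rfl disjoint_sdiff_left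
  rw [hunion, ← _root_.Matroid.eRank_def] at hr
  have hcard := ncard_sdiff_add_ncard_of_subset hK M.ground_finite
  -- everything is finite: pass to ℕ
  have hKfin : M.coloops.Finite := M.ground_finite.subset hK
  have hrE' : M.eRk (M.E \ M.coloops) ≠ ⊤ :=
    ne_top_of_le_ne_top (M.ground_finite.subset hE').encard_lt_top.ne (M.eRk_le_encard _)
  obtain ⟨r', hr'⟩ := ENat.ne_top_iff_exists.1 hrE'
  obtain ⟨R, hR⟩ := ENat.ne_top_iff_exists.1 (PercRepro.Matroid.eRank_ne_top_of_finite M)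
  have hRk : R = r' + M.coloops.ncard := by
    have := hr
    rw [← hR, ← hr', ← Set.Finite.cast_ncard_eq hKfin] at this
    exact_mod_cast this
  have hEn : M.E.ncard = R + 5 := by
    have := hd
    rw [← hR, ← Set.Finite.cast_ncard_eq M.ground_finite] at this
    exact_mod_cast this
  have hE'n : (M.E \ M.coloops).ncard = r' + 5 := by omega
  -- `r' ≥ 4` by the core's point bounds
  by_contra hlt
  push Not at hlt
  have hr'3 : r' ≤ 3 := by omega
  have h6 := ThmN.ncard_le_six_of_eRk_le_three_of_free M hfree hE' (by rw [← hr']; exact_mod_cast hr'3)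
  have hr'1 : r' ≤ 1 := by omega
  have h2 := ThmN.ncard_add_one_le_two_pow_of_eRk_le M (ThmN.not_isLoop_of_free M hfree) hfree 1
    (M.E \ M.coloops) hE' (by rw [← hr']; exact_mod_cast hr'1)
  norm_num at h2
  omega

open Classical in
/-- **The averaging recursion with an explicit count of non-coloops**: on a core of nullity `d + 1` with at least
`m ≥ 1` non-coloops, if every core of nullity `d` has `s₄ ≤ B`, then `s₄ − ⌊4·s₄/m⌋ ≤ B` (p1's
`ncard_fourCircuits_sub_div_le` with `d + 6` replaced by `m`). -/
theorem ncard_fourCircuits_sub_div_le_of_nonColoops (M : Matroid α) [M.Finite]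
    (hfree : ∀ e ∈ M.E, ∃ A ⊆ M.E \ {e}, e ∉ M.closure A ∧ e ∉ M.closure ((M.E \ {e}) \ A))
    {d : ℕ} (hd : M.E.encard = M.eRank + (d + 1)) {m : ℕ} (hm0 : 0 < m)
    (hm : m ≤ (M.E \ M.coloops).ncard) {B : ℕ}
    (hB : ∀ (M' : Matroid α) [M'.Finite],
      (∀ e ∈ M'.E, ∃ A ⊆ M'.E \ {e}, e ∉ M'.closure A ∧ e ∉ M'.closure ((M'.E \ {e}) \ A)) →
      M'.E.encard = M'.eRank + d → {C : Set α | M'.IsCircuit C ∧ C.ncard = 4}.ncard ≤ B) :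
    {C : Set α | M.IsCircuit C ∧ C.ncard = 4}.ncard -
      4 * {C : Set α | M.IsCircuit C ∧ C.ncard = 4}.ncard / m ≤ B := by
  rcases Nat.eq_zero_or_pos {C : Set α | M.IsCircuit C ∧ C.ncard = 4}.ncard with h0 | hpos
  · rw [h0]; simp
  obtain ⟨x, hxE, hxc, hx⟩ := exists_nonColoop_ncard_fourCircuitsThrough_le M hpos
  -- the non-coloops number at least `m`
  have hm' : m ≤ (M.ground_finite.toFinset.filter (fun x => ¬ M.IsColoop x)).card := by
    have : (M.ground_finite.toFinset.filter (fun x => ¬ M.IsColoop x) : Set α) = M.E \ M.coloops := by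
      ext y; simp only [Finset.coe_filter, Set.Finite.mem_toFinset, mem_setOf_eq, mem_sdiff,
        Matroid.isColoop_iff_mem_coloops]
    rw [← ncard_coe_finset, this]
    exact hm
  have hx' : {C : Set α | M.IsCircuit C ∧ C.ncard = 4 ∧ x ∈ C}.ncard ≤
      4 * {C : Set α | M.IsCircuit C ∧ C.ncard = 4}.ncard / m :=
    hx.trans (Nat.div_le_div_left hm' hm0)
  -- `M ＼ {x}` is a core of nullity `d`
  have hν : M✶.eRank = ((d + 1 : ℕ) : ℕ∞) := by
    have h := _root_.Matroid.eRank_add_eRank_dual M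
    rw [hd] at h
    exact WithTop.add_left_cancel (PercRepro.Matroid.eRank_ne_top_of_finite M) h
  have hdel := PercRepro.Matroid.dual_eRank_delete_singleton_add_one hxE hxc
  rw [hν] at hdel
  have hfin' : (M ＼ {x})✶.eRank ≠ ⊤ := by
    intro h
    rw [h] at hdel
    have h2 : ((d + 1 : ℕ) : ℕ∞) = ⊤ := by rw [← hdel]; simp
    exact ENat.coe_ne_top _ h2
  obtain ⟨d', hd'⟩ := ENat.ne_top_iff_exists.1 hfin'
  have hdd' : d = d' := by
    rw [← hd'] at hdel
    have : d' + 1 = d + 1 := by exact_mod_cast hdel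
    omega
  subst hdd'
  have hd'enc : (M ＼ {x}).E.encard = (M ＼ {x}).eRank + d := by
    have h := _root_.Matroid.eRank_add_eRank_dual (M ＼ {x})
    rw [← hd'] at h
    exact h.symm
  have hB' := hB (M ＼ {x}) (hfree_delete M hfree x) hd'enc
  have hsplit := ncard_fourCircuits_le_through_add_delete M x
  omega

/-- **`s₄ ≤ 32` on every core of nullity `5`, unconditionally**: the averaging recursion with `m = 9` on
`s₄ ≤ capKer 4 = 18` at nullity `4` — `s − ⌊4s/9⌋ ≤ 18 ⟹ s ≤ 32`. -/
theorem ncard_fourCircuits_le_thirty_two_uncond (M : Matroid α) [M.Finite]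
    (hfree : ∀ e ∈ M.E, ∃ A ⊆ M.E \ {e}, e ∉ M.closure A ∧ e ∉ M.closure ((M.E \ {e}) \ A))
    (hd : M.E.encard = M.eRank + 5) : {C : Set α | M.IsCircuit C ∧ C.ncard = 4}.ncard ≤ 32 := by
  have hd' : M.E.encard = M.eRank + ((4 : ℕ) + 1) := by rw [hd]; norm_num
  have h18 : capKer 4 = 18 := by decide
  have h := ncard_fourCircuits_sub_div_le_of_nonColoops M hfree hd' (by norm_num)
    (card_nonColoops_ge_nine M hfree hd) (B := 18)
    (fun M' _ hfree' hd4 => by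
      have h := ncard_fourCircuits_le_capKer M' hfree' (d := 4) hd4
      omega)
  omega

end S1

end PercRepro
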